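import Literature.Topology.FourManifolds.ClosedBall
import Literature.Topology.FourManifolds.FramedTubularNbhd
import Literature.Topology.FourManifolds.NormalRetraction
import HarnessLib

/-!
# The normal projection field of an immersion of an abstract manifold into a round sphere

Topic `Literature/Topology/FourManifolds`; first file of the generalisation of the tree's 2-knot
pipeline `TwoKnotNormalSection.lean` / `TwoKnotNormalTube.lean` / `TwoKnotNormalEuler.lean`
(Kirby, *The Topology of 4-Manifolds* (1989), Ch. VIII, Thm. 2 for `S² ⊆ S⁴`) from the round
`S²` to an **abstract manifold** `M` (charted on `ℝⁿ`) smoothly immersed in a round sphere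
`f : M → 𝕊ᴺ ⊆ ℝᴺ⁺¹` — towards Kirby's Thm. VIII.2 for `Q = S^{n+2}`: *a closed oriented `Mⁿ`
smoothly embedded in `S^{n+2}` has trivial normal bundle*, the input `W₄` needs in the proof of
Thm. VIII.1 (A) (`Ω₄^{SO} → ℤ` is injective; fact seat
`Literature.Topology.FourManifolds.isOrientedBordant_of_isEmpty_of_signature_eq_zero`).

For `x : M` the **normal space** `ν_x = (ℝ f x ⊕ d(ι ∘ f)_x(T_x M))ᗮ ⊆ T_{f x} 𝕊ᴺ` of `f`
inside the sphere (`norSpace`) and the **normal projection** `Q_x`, the orthogonal projection of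
`ℝᴺ⁺¹` onto `ν_x` (`norProj`, Mathlib's `Submodule.starProjection`). They are defined without
charts, through the tree's `Literature.Topology.FourManifolds.ambientDeriv` (Mathlib's `mfderiv`
of `ι ∘ f`), whose range is the tree's `Literature.Topology.FourManifolds.tangentPlane` of
`ι ∘ f` (`NormalRetraction.lean`). Since `f x ⊥ d(ι ∘ f)_x(T_x M)` (the image lies on the unit
sphere), `Q_x = 1 - P_x - ⟪f x, ·⟫ f x` with `P_x` the tree's `tangentProj` (`norProj_eq`), and
the tree's `contMDiff_tangentProj` (`NormalRetraction.lean`: the field of tangent projections of a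
smooth map with injective differential is `C^∞`) gives at once that **`x ↦ Q_x` is a `C^∞` field
of operators** (`contMDiff_norProj`) — the generalisation of `TwoKnotNormalTube.contMDiff_norProj`
from the round `S²` to abstract `M`.

Also: the algebra of `Q_x` (`mem_norSpace_iff`, `norProj_eq_self_iff`, `norProj_coe`,
`norProj_ambientDeriv`, `norm_norProj_le`, `norProj_eq_sub_of_forall_inner`,
`forall_inner_ambientDeriv_eq_zero_iff`), the dimension count `dim ν_x + n = N`
(`finrank_norSpace`) and the expansion of `Q_x` in an orthonormal normal frame
(`norProj_eq_sum_inner_smul`).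

Everything is proved; no named facts are introduced (D-0026).

## References

* R. C. Kirby, *The Topology of 4-Manifolds*, LNM 1374, Springer (1989), Ch. VIII, Thm. 2 and its
  proof, pp. 44–45. [Kirby1989]
* M. W. Hirsch, *Differential Topology*, GTM 33 (1976), Ch. 4, §2 (the normal bundle of a
  submanifold of `ℝⁿ`) and §5 (tubular neighbourhoods). [HirschDT1976]
-/

open scoped Manifold ContDiff Topology RealInnerProductSpace
open Set Function Module Filter

noncomputable section

namespace Literature.Topology.FourManifolds

/-- Local notation: `𝔼 n` is the model Euclidean space `EuclideanSpace ℝ (Fin n)`. -/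
local notation "𝔼 " n:arg => EuclideanSpace ℝ (Fin n)

/-- Local notation: `𝕊 n` is the unit sphere in `EuclideanSpace ℝ (Fin (n + 1))`. -/
local notation "𝕊 " n:arg => (Metric.sphere (0 : EuclideanSpace ℝ (Fin (n + 1))) 1)

section Immersion

variable {n N : ℕ} {M : Type*} [TopologicalSpace M] [ChartedSpace (𝔼 n) M] {f : M → 𝕊 N}

attribute [local instance] fact_finrank_euclideanSpace_succ

variable (f) in
/-- The map `ι ∘ f : M → ℝᴺ⁺¹` of an `f : M → 𝕊ᴺ`. [folklore] -/
abbrev sphCoe (x : M) : 𝔼 (N + 1) := (f x : 𝔼 (N + 1))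

/-- The tangent plane of `ι ∘ f` (tree's `tangentPlane`) is the range of the ambient differential
(tree's `ambientDeriv`): the two are the same `mfderiv`. [folklore] -/
theorem tangentPlane_sphCoe (x : M) :
    tangentPlane (𝓡 n) (sphCoe f) x =
      LinearMap.range (ambientDeriv (𝓡 n) f x : 𝔼 n →ₗ[ℝ] 𝔼 (N + 1)) := rfl

variable (n f) in
/-- The **tangent-and-position space** `ℝ f x ⊕ d(ι ∘ f)_x(T_x M) ⊆ ℝᴺ⁺¹` of `f` at `x`.
[folklore] -/
def tanSpace (x : M) : Submodule ℝ (𝔼 (N + 1)) :=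
  (ℝ ∙ (f x : 𝔼 (N + 1))) ⊔ tangentPlane (𝓡 n) (sphCoe f) x

variable (n f) in
/-- The **normal space** `ν_x = (ℝ f x ⊕ d(ι ∘ f)_x(T_x M))ᗮ ⊆ T_{f x} 𝕊ᴺ` of `f` at `x` inside the
sphere (Hirsch, Ch. 4 §2). [folklore] -/
def norSpace (x : M) : Submodule ℝ (𝔼 (N + 1)) := (tanSpace n f x)ᗮ

variable (n f) in
/-- The **normal projection** `Q_x`: the orthogonal projection of `ℝᴺ⁺¹` onto `ν_x`, as an
operator on `ℝᴺ⁺¹`. [folklore] -/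
def norProj (x : M) : 𝔼 (N + 1) →L[ℝ] 𝔼 (N + 1) := (norSpace n f x).starProjection

/-- Membership in the normal space: orthogonality to `f x` and to the tangent plane. [folklore] -/
theorem mem_norSpace_iff {x : M} {z : 𝔼 (N + 1)} :
    z ∈ norSpace n f x ↔ ⟪z, (f x : 𝔼 (N + 1))⟫ = 0 ∧ ∀ v, ⟪z, ambientDeriv (𝓡 n) f x v⟫ = 0 := by
  rw [norSpace, tanSpace, ← Submodule.inf_orthogonal, Submodule.mem_inf,
    Submodule.mem_orthogonal_singleton_iff_inner_left, Submodule.mem_orthogonal]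
  refine and_congr Iff.rfl ⟨fun h v => ?_, fun h u hu => ?_⟩
  · rw [real_inner_comm]
    exact h _ ⟨v, rfl⟩
  · obtain ⟨v, rfl⟩ := hu
    rw [real_inner_comm]
    exact h v

/-- Normal vectors (in the sphere) are normal vectors of `ι ∘ f` (tree's `normalSpace`).
[folklore] -/
theorem mem_normalSpace_of_mem_norSpace {x : M} {z : 𝔼 (N + 1)} (hz : z ∈ norSpace n f x) :
    z ∈ normalSpace (𝓡 n) (sphCoe f) x := by
  rw [normalSpace, Submodule.mem_orthogonal]
  rintro u ⟨v, rfl⟩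
  rw [real_inner_comm]
  exact (mem_norSpace_iff.1 hz).2 v

/-- `Q_x z ∈ ν_x`. [folklore] -/
theorem norProj_apply_mem (x : M) (z : 𝔼 (N + 1)) : norProj n f x z ∈ norSpace n f x :=
  Submodule.starProjection_apply_mem _ z

/-- **Fixed vectors of `Q_x` are exactly the normal vectors.** [folklore] -/
theorem norProj_eq_self_iff {x : M} {z : 𝔼 (N + 1)} :
    norProj n f x z = z ↔ ⟪z, (f x : 𝔼 (N + 1))⟫ = 0 ∧ ∀ v, ⟪z, ambientDeriv (𝓡 n) f x v⟫ = 0 := by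
  rw [norProj, Submodule.starProjection_eq_self_iff, mem_norSpace_iff]

/-- `Q_x` is idempotent. [folklore] -/
theorem norProj_norProj (x : M) (z : 𝔼 (N + 1)) : norProj n f x (norProj n f x z) = norProj n f x z :=
  Submodule.starProjection_eq_self_iff.2 (norProj_apply_mem x z)

/-- `Q_x` is symmetric. [folklore] -/
theorem inner_norProj_comm (x : M) (z w : 𝔼 (N + 1)) : ⟪norProj n f x z, w⟫ = ⟪z, norProj n f x w⟫ :=
  Submodule.inner_starProjection_left_eq_right _ z w

/-- `‖Q_x z‖ ≤ ‖z‖`. [folklore] -/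
theorem norm_norProj_le (x : M) (z : 𝔼 (N + 1)) : ‖norProj n f x z‖ ≤ ‖z‖ :=
  ((norProj n f x).le_opNorm z).trans
    (mul_le_of_le_one_left (norm_nonneg _) (Submodule.starProjection_norm_le _))

/-- `Q_x = 1 - Π_x` with `Π_x` the orthogonal projection onto `ℝ f x ⊕ T_x`. [folklore] -/
theorem norProj_eq_id_sub (x : M) :
    norProj n f x = ContinuousLinearMap.id ℝ _ - (tanSpace n f x).starProjection :=
  Submodule.starProjection_orthogonal _

/-- `Q_x` kills `ℝ f x ⊕ T_x`. [folklore] -/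
theorem norProj_apply_eq_zero_of_mem {x : M} {z : 𝔼 (N + 1)} (hz : z ∈ tanSpace n f x) :
    norProj n f x z = 0 := by
  rw [norProj_eq_id_sub]
  simp [Submodule.starProjection_eq_self_iff.2 hz]

/-- `Q_x (f x) = 0`. [folklore] -/
theorem norProj_coe (x : M) : norProj n f x (f x) = 0 :=
  norProj_apply_eq_zero_of_mem (Submodule.mem_sup_left (Submodule.mem_span_singleton_self _))

/-- `Q_x` kills the ambient differential `d(ι ∘ f)_x(T_x M)`. [folklore] -/
theorem norProj_ambientDeriv (x : M) (v : 𝔼 n) : norProj n f x (ambientDeriv (𝓡 n) f x v) = 0 :=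
  norProj_apply_eq_zero_of_mem (Submodule.mem_sup_right ⟨v, rfl⟩)

/-- `Q_x z ⊥ f x`. [folklore] -/
theorem inner_norProj_coe (x : M) (z : 𝔼 (N + 1)) : ⟪norProj n f x z, (f x : 𝔼 (N + 1))⟫ = 0 :=
  (norProj_eq_self_iff.1 (norProj_norProj x z)).1

/-- `Q_x z ⊥ d(ι ∘ f)_x v`. [folklore] -/
theorem inner_norProj_ambientDeriv (x : M) (z : 𝔼 (N + 1)) (v : 𝔼 n) :
    ⟪norProj n f x z, ambientDeriv (𝓡 n) f x v⟫ = 0 :=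
  (norProj_eq_self_iff.1 (norProj_norProj x z)).2 v

section Smooth

variable (hf : ContMDiff (𝓡 n) (𝓡 N) ∞ f)
include hf

/-- `ι ∘ f : M → ℝᴺ⁺¹` is smooth. [folklore] -/
theorem contMDiff_sphCoe : ContMDiff (𝓡 n) 𝓘(ℝ, 𝔼 (N + 1)) ∞ (sphCoe f) :=
  contMDiff_coe_sphere.comp hf

/-- The ambient differential is the derivative of the inclusion composed with `df`. [folklore] -/
theorem ambientDeriv_eq_comp (x : M) :
    ambientDeriv (𝓡 n) f x = (mfderiv (𝓡 N) 𝓘(ℝ, 𝔼 (N + 1)) (Subtype.val : 𝕊 N → 𝔼 (N + 1))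
      (f x)).comp (mfderiv (𝓡 n) (𝓡 N) f x) := by
  rw [ambientDeriv]
  change mfderiv (𝓡 n) 𝓘(ℝ, 𝔼 (N + 1)) ((Subtype.val : 𝕊 N → 𝔼 (N + 1)) ∘ f) x = _
  exact mfderiv_comp x ((contMDiff_coe_sphere (m := ∞)).mdifferentiableAt (by simp))
    (hf.mdifferentiableAt (by simp))

/-- The tangent plane of `f` lies in `T_{f x} 𝕊ᴺ = (f x)ᗮ`: `⟪d(ι ∘ f)_x v, f x⟫ = 0`. [folklore] -/
theorem inner_ambientDeriv_coe (x : M) (v : 𝔼 n) :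
    ⟪ambientDeriv (𝓡 n) f x v, (f x : 𝔼 (N + 1))⟫ = 0 := by
  have h := range_mfderiv_coe_sphere (n := N) (f x)
  have hmem : ambientDeriv (𝓡 n) f x v ∈ LinearMap.range
      (mfderiv (𝓡 N) 𝓘(ℝ, 𝔼 (N + 1)) (Subtype.val : 𝕊 N → 𝔼 (N + 1)) (f x)).toLinearMap := by
    rw [ambientDeriv_eq_comp hf]
    exact ⟨_, rfl⟩
  rw [h] at hmem
  have hmem' : ambientDeriv (𝓡 n) f x v ∈ (ℝ ∙ (f x : 𝔼 (N + 1)))ᗮ := hmem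
  rw [Submodule.mem_orthogonal_singleton_iff_inner_right] at hmem'
  rwa [real_inner_comm]

/-- `⟪f x, d(ι ∘ f)_x v⟫ = 0`. [folklore] -/
theorem inner_coe_ambientDeriv (x : M) (v : 𝔼 n) :
    ⟪(f x : 𝔼 (N + 1)), ambientDeriv (𝓡 n) f x v⟫ = 0 := by
  rw [real_inner_comm]; exact inner_ambientDeriv_coe hf x v

/-- The position vector is a normal vector of `ι ∘ f` (tree's `normalSpace`). [folklore] -/
theorem coe_mem_normalSpace (x : M) : (f x : 𝔼 (N + 1)) ∈ normalSpace (𝓡 n) (sphCoe f) x := by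
  rw [normalSpace, Submodule.mem_orthogonal]
  rintro u ⟨v, rfl⟩
  exact inner_ambientDeriv_coe hf x v

/-- For an immersion the ambient differential is injective. [folklore] -/
theorem injective_ambientDeriv {x : M} (hf' : Injective (mfderiv (𝓡 n) (𝓡 N) f x)) :
    Injective (ambientDeriv (𝓡 n) f x) := by
  rw [ambientDeriv_eq_comp hf]
  exact (mfderiv_coe_sphere_injective (f x)).comp hf'

/-- **The normal projection through the tangent projection**:
`Q_x = 1 - P_x - ⟪f x, ·⟫ f x`, with `P_x` the tree's `tangentProj` of `ι ∘ f` (the projections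
onto the orthogonal summands `T_x` and `ℝ f x` add up to the projection onto `ℝ f x ⊕ T_x`).
[folklore] -/
theorem norProj_eq (x : M) :
    norProj n f x = ContinuousLinearMap.id ℝ _ - tangentProj (𝓡 n) (sphCoe f) x -
      (innerSL ℝ (f x : 𝔼 (N + 1))).smulRight (f x : 𝔼 (N + 1)) := by
  have h1 : ‖(f x : 𝔼 (N + 1))‖ = 1 := norm_eq_of_mem_sphere (f x)
  refine ContinuousLinearMap.ext fun z => ?_
  change norProj n f x z = z - tangentProj (𝓡 n) (sphCoe f) x z -
    ⟪(f x : 𝔼 (N + 1)), z⟫ • (f x : 𝔼 (N + 1))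
  refine Submodule.eq_starProjection_of_mem_of_inner_eq_zero ?_ ?_
  · -- `z - P z - ⟪f x, z⟫ f x` is a normal vector
    rw [mem_norSpace_iff]
    have hPn : ∀ v, ⟪z - tangentProj (𝓡 n) (sphCoe f) x z, ambientDeriv (𝓡 n) f x v⟫ = 0 := by
      intro v
      exact Submodule.inner_left_of_mem_orthogonal (K := tangentPlane (𝓡 n) (sphCoe f) x)
        ⟨v, rfl⟩ (sub_tangentProj_apply_mem_orthogonal _ x z)
    have hPa : ⟪tangentProj (𝓡 n) (sphCoe f) x z, (f x : 𝔼 (N + 1))⟫ = 0 := by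
      obtain ⟨v, hv⟩ := (mem_tangentPlane_iff.1 (tangentProj_apply_mem (I := 𝓡 n) (sphCoe f) x z))
      rw [← hv]
      exact inner_ambientDeriv_coe hf x v
    refine ⟨?_, fun v => ?_⟩
    · rw [inner_sub_left, inner_sub_left, hPa, inner_smul_left, real_inner_self_eq_norm_sq, h1,
        real_inner_comm]
      simp
    · rw [inner_sub_left, hPn, inner_smul_left, inner_coe_ambientDeriv hf]
      simp
  · -- the difference `P z + ⟪f x, z⟫ f x` lies in `ℝ f x ⊕ T_x`
    intro w hw
    have hdiff : z - (z - tangentProj (𝓡 n) (sphCoe f) x z - ⟪(f x : 𝔼 (N + 1)), z⟫ • (f x : 𝔼 (N + 1))) =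
        ⟪(f x : 𝔼 (N + 1)), z⟫ • (f x : 𝔼 (N + 1)) + tangentProj (𝓡 n) (sphCoe f) x z := by abel
    rw [hdiff]
    exact Submodule.inner_right_of_mem_orthogonal
      (Submodule.add_mem _ (Submodule.mem_sup_left (Submodule.smul_mem _ _
        (Submodule.mem_span_singleton_self _)))
        (Submodule.mem_sup_right (tangentProj_apply_mem _ x z))) hw

/-- **The normal projection field of a smooth immersion into a round sphere is `C^∞`** (from the
tree's `contMDiff_tangentProj`). [cite: HirschDT1976, Ch. 4 §2] -/
theorem contMDiff_norProj [IsManifold (𝓡 n) ∞ M] (hf' : ∀ x, Injective (mfderiv (𝓡 n) (𝓡 N) f x)) :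
    ContMDiff (𝓡 n) 𝓘(ℝ, 𝔼 (N + 1) →L[ℝ] 𝔼 (N + 1)) ∞ fun x => norProj n f x := by
  have hP := contMDiff_tangentProj (I := 𝓡 n) (contMDiff_sphCoe hf)
    (fun x => injective_ambientDeriv hf (hf' x))
  have hF := contMDiff_sphCoe hf
  have h3 : ContMDiff (𝓡 n) 𝓘(ℝ, 𝔼 (N + 1) →L[ℝ] 𝔼 (N + 1)) ∞
      fun x => (innerSL ℝ (f x : 𝔼 (N + 1))).smulRight (f x : 𝔼 (N + 1)) := by
    have h4 : ContMDiff (𝓡 n) 𝓘(ℝ, 𝔼 (N + 1) →L[ℝ] ℝ) ∞ fun x => innerSL ℝ (f x : 𝔼 (N + 1)) :=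
      ((innerSL ℝ (E := 𝔼 (N + 1))).contDiff.of_le le_top).comp_contMDiff hF
    exact ((isBoundedBilinearMap_smulRight (𝕜 := ℝ) (E := 𝔼 (N + 1)) (F := 𝔼 (N + 1))).contDiff.of_le
      le_top).comp_contMDiff (h4.prodMk_space hF)
  have : (fun x => norProj n f x) = fun x => ContinuousLinearMap.id ℝ _ -
      tangentProj (𝓡 n) (sphCoe f) x - (innerSL ℝ (f x : 𝔼 (N + 1))).smulRight (f x : 𝔼 (N + 1)) :=
    funext fun x => norProj_eq hf x
  rw [this]
  exact (contMDiff_const.sub hP).sub h3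

/-- The normal projection field is continuous. [folklore] -/
theorem continuous_norProj [IsManifold (𝓡 n) ∞ M] (hf' : ∀ x, Injective (mfderiv (𝓡 n) (𝓡 N) f x)) :
    Continuous fun x => norProj n f x :=
  (contMDiff_norProj hf hf').continuous

/-- For `z` orthogonal to the tangent plane, `Q_x z = z - ⟪z, f x⟫ f x`. [folklore] -/
theorem norProj_eq_sub_of_forall_inner {x : M} {z : 𝔼 (N + 1)}
    (hz : ∀ v, ⟪z, ambientDeriv (𝓡 n) f x v⟫ = 0) :
    norProj n f x z = z - ⟪z, (f x : 𝔼 (N + 1))⟫ • (f x : 𝔼 (N + 1)) := by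
  have h1 : ‖(f x : 𝔼 (N + 1))‖ = 1 := norm_eq_of_mem_sphere (f x)
  refine Submodule.eq_starProjection_of_mem_of_inner_eq_zero ?_ ?_
  · rw [mem_norSpace_iff]
    refine ⟨?_, fun v => ?_⟩
    · rw [inner_sub_left, inner_smul_left, real_inner_self_eq_norm_sq, h1]
      simp
    · rw [inner_sub_left, inner_smul_left, hz, inner_coe_ambientDeriv hf]
      simp
  · intro w hw
    rw [sub_sub_cancel]
    exact Submodule.inner_right_of_mem_orthogonal
      (Submodule.mem_sup_left (Submodule.smul_mem _ _ (Submodule.mem_span_singleton_self _))) hw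

/-- **Normality is a fixed-point condition for `Q`**: `z` is orthogonal to the tangent plane at `x`
iff `Q_x` fixes `z - ⟪z, f x⟫ f x` (a closed condition in `(x, z)` once `Q` is known to be
continuous). [folklore] -/
theorem forall_inner_ambientDeriv_eq_zero_iff (x : M) (z : 𝔼 (N + 1)) :
    (∀ v, ⟪z, ambientDeriv (𝓡 n) f x v⟫ = 0) ↔
      norProj n f x (z - ⟪z, (f x : 𝔼 (N + 1))⟫ • (f x : 𝔼 (N + 1))) =
        z - ⟪z, (f x : 𝔼 (N + 1))⟫ • (f x : 𝔼 (N + 1)) := by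
  constructor
  · intro hz
    have h := norProj_eq_sub_of_forall_inner hf hz
    rw [map_sub, map_smul, norProj_coe, smul_zero, sub_zero, h]
  · intro h v
    have h2 := (norProj_eq_self_iff.1 h).2 v
    rwa [inner_sub_left, inner_smul_left, inner_coe_ambientDeriv hf, mul_zero, sub_zero] at h2

omit hf in
/-- The normality condition in terms of the tree's normal space of `ι ∘ f`. [folklore] -/
theorem forall_inner_ambientDeriv_eq_zero_iff_mem_normalSpace (x : M) (z : 𝔼 (N + 1)) :
    (∀ v, ⟪z, ambientDeriv (𝓡 n) f x v⟫ = 0) ↔ z ∈ normalSpace (𝓡 n) (sphCoe f) x := by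
  rw [normalSpace, Submodule.mem_orthogonal]
  constructor
  · rintro h u ⟨v, rfl⟩
    rw [real_inner_comm]; exact h v
  · intro h v
    rw [real_inner_comm]; exact h _ ⟨v, rfl⟩

/-- The position vector is not in the tangent plane; the sum `ℝ f x ⊔ T_x` is direct. [folklore] -/
theorem span_inf_tangentPlane_eq_bot (x : M) :
    (ℝ ∙ (f x : 𝔼 (N + 1))) ⊓ tangentPlane (𝓡 n) (sphCoe f) x = ⊥ := by
  rw [Submodule.eq_bot_iff]
  rintro y ⟨hy1, ⟨v, hv⟩⟩
  obtain ⟨c, hc⟩ := Submodule.mem_span_singleton.1 hy1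
  have h0 : ⟪y, (f x : 𝔼 (N + 1))⟫ = 0 := by
    rw [← hv]
    exact inner_ambientDeriv_coe hf x v
  rw [← hc, inner_smul_left, real_inner_self_eq_norm_sq, norm_eq_of_mem_sphere] at h0
  have hc0 : c = 0 := by simpa using h0
  rw [← hc, hc0, zero_smul]

/-- **Dimension of the normal space**: `dim ν_x + n = N` for an immersion of an `n`-manifold in
`𝕊ᴺ`. [folklore] -/
theorem finrank_norSpace {x : M} (hf' : Injective (mfderiv (𝓡 n) (𝓡 N) f x)) :
    finrank ℝ (norSpace n f x) + n = N := by
  have hline : finrank ℝ (ℝ ∙ (f x : 𝔼 (N + 1))) = 1 :=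
    finrank_span_singleton (ne_zero_of_mem_unit_sphere (f x))
  have hrange : finrank ℝ (tangentPlane (𝓡 n) (sphCoe f) x) = n := by
    have := LinearMap.finrank_range_of_inj (injective_ambientDeriv hf hf')
    rw [tangentPlane_sphCoe, this, finrank_euclideanSpace_fin]
  have hsup := Submodule.finrank_sup_add_finrank_inf_eq (ℝ ∙ (f x : 𝔼 (N + 1)))
    (tangentPlane (𝓡 n) (sphCoe f) x)
  rw [span_inf_tangentPlane_eq_bot hf x, finrank_bot, add_zero, hline, hrange] at hsup
  have htot := Submodule.finrank_add_finrank_orthogonal (tanSpace n f x)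
  rw [finrank_euclideanSpace_fin] at htot
  change finrank ℝ (tanSpace n f x) = 1 + n at hsup
  change finrank ℝ (tanSpace n f x) + finrank ℝ (norSpace n f x) = N + 1 at htot
  omega

/-- **An orthonormal family of `N - n` normal vectors spans the normal space**: if `u` is orthonormal,
consists of normal vectors and has the right cardinality then `Q_x p = ∑ ⟪uᵢ, p⟫ uᵢ`. [folklore] -/
theorem norProj_eq_sum_inner_smul {k : ℕ} {x : M} (hf' : Injective (mfderiv (𝓡 n) (𝓡 N) f x))
    (hk : n + k = N) {u : Fin k → 𝔼 (N + 1)} (hu : Orthonormal ℝ u)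
    (hQu : ∀ i, norProj n f x (u i) = u i) (p : 𝔼 (N + 1)) :
    norProj n f x p = ∑ i, ⟪u i, p⟫ • u i := by
  have hdim : finrank ℝ (norSpace n f x) = k := by
    have := finrank_norSpace hf hf'
    omega
  have hmem : ∀ i, u i ∈ norSpace n f x := fun i =>
    Submodule.starProjection_eq_self_iff.1 (hQu i)
  let u' : Fin k → norSpace n f x := fun i => ⟨u i, hmem i⟩
  have hu' : Orthonormal ℝ u' := by
    refine ⟨fun i => ?_, fun i j hij => ?_⟩
    · change ‖u i‖ = 1
      exact hu.1 i
    · change ⟪u i, u j⟫ = 0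
      exact hu.2 hij
  have hsp : ⊤ ≤ Submodule.span ℝ (Set.range u') := by
    have hli := hu'.linearIndependent
    have hcard : Fintype.card (Fin k) = finrank ℝ (norSpace n f x) := by
      rw [Fintype.card_fin, hdim]
    exact (hli.span_eq_top_of_card_eq_finrank' hcard).ge
  let b : OrthonormalBasis (Fin k) ℝ (norSpace n f x) := OrthonormalBasis.mk hu' hsp
  have hb : ∀ i, (b i : 𝔼 (N + 1)) = u i := fun i => by
    simp [b, u']
  rw [norProj, Submodule.starProjection_apply, b.orthogonalProjectionOnto_apply_eq_sum]
  simp [hb]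

end Smooth

end Immersion

end Literature.Topology.FourManifolds
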